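import Mathlib.GroupTheory.OrderOfElement
import Mathlib.Data.ZMod.Basic
import Mathlib.Algebra.GroupWithZero.Units.Fintype
import Mathlib.NumberTheory.ArithmeticFunction.Zeta
import Mathlib.NumberTheory.ArithmeticFunction.Moebius
import Mathlib.Data.Nat.Totient
import Mathlib.Algebra.BigOperators.Associated
import Literature.NumberTheory.LFunctions.MertensElementary
import Literature.NumberTheory.Sieve.PrimePairsSieveBound
import HarnessLib

/-!
# Romanov's theorem, and the Pintz–Ruzsa count `s(N)` for primes and powers of `2`

Topic `Literature/NumberTheory/Sieve` (additive problems with primes and powers of `2`). Everything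
in this file is PROVED; there are no named facts.

**Romanov's theorem** (Romanoff 1934): a positive proportion of the positive integers are of the
form `p + 2^k`. We follow Nathanson, *Additive Number Theory: The Classical Bases* (GTM 164, 1996),
§7.6 (Lemmas 7.8–7.10, Theorem 7.11, case `a = 2`), whose three steps are

* Lemma 7.8 (Romanov's lemma): `∑_{(d,2)=1} 1/(d e(d)) < ∞`, `e(d)` = the order of `2` modulo `d`;
* Lemma 7.9: `∑_{n ≤ x} r(n)² ≪ x` for `r(n) = #{(p, k) : p + 2^k = n}`, by the upper-bound sieve
  for prime pairs `p, p + h` (`h = 2^{k₁} - 2^{k₂}`) and Lemma 7.8;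
* Lemma 7.10 + Theorem 7.11: `∑_{n ≤ x} r(n) ≫ x` and Cauchy–Schwarz.

The count of Lemma 7.9 is, verbatim, the quantity
`s(N) = #{(p₁, p₂, m₁, m₂) : p₁ - p₂ = 2^{m₂} - 2^{m₁}, pⱼ ≤ N, 1 ≤ mⱼ ≤ L = ⌊log₂ N⌋} = ∫₀¹ |S(α)G(α)|² dα`
of Pintz–Ruzsa, *On Linnik's approximation to Goldbach's problem, I*, Acta Arith. 109 (2003), §8,
(8.2)–(8.4), whose Lemma 10 (`s(N) ≤ (2C₂/log² 2) N`, `C₂ < 5.3636`, via Chen's prime-pair constant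
`3.9171` and `R₀ < 1.94`) is the mean-value input of the proof of the Goldbach–Linnik theorem with
`K = 8` (the named fact `Literature.NumberTheory.Sieve.goldbach_linnik`, parity.S36). This file
proves the ORDER OF MAGNITUDE `s(N) ≤ C N` (`card_primePowTwoQuadruples_le`) from the tree's
unspecified-constant sieve bound `Literature.NumberTheory.Sieve.primePairs_card_le`; the sharp
constant is a separate matter (Chen's theorem with constants, and the numerical value of `R₀`).

## Contents (all proved)

§1 The order of `2`: `ordTwo d = e(d)`; `dvd_two_pow_sub_one_iff` (`d ∣ 2^l - 1 ↔ e(d) ∣ l`),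
  `lt_two_pow_ordTwo` (`d < 2^{e(d)}` for odd `d`), `ordTwo_dvd_ordTwo_of_dvd`.
§2 Romanov's product: `primesOrdLE x` (odd primes with `e(p) ≤ x`), `romanovD x = ∏_{k ≤ x}(2^k - 1)`,
  `prod_primesOrdLE_le` (`∏ p ≤ D(x) ≤ 2^{x²}`), `card_filter_lt_mul_log_le`,
  `sum_primesOrdLE_inv_pred_le` (`∑_{p ∈ primesOrdLE x} 1/(p-1) ≤ log log x + 7`, from the tree's
  elementary Mertens bound `Literature.NumberTheory.LFunctions.MertensBound.sum_inv_prime_le`).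
§3 `E(x)`: `sum_inv_totient_le_prod` (square-free sums against `∏(1 + 1/(p-1))`),
  `sum_inv_totient_le_log` (`∑ 1/φ(d) ≤ e⁷ log x` over odd square-free `d` with `e(d) ≤ x`).
§4 **Romanov's lemma** `sum_inv_totient_mul_ordTwo_le`: `∑_{d odd, sq-free} 1/(φ(d) e(d)) ≤ 3e⁷`
  (dyadic blocks in `e(d)` instead of partial summation), and its summed form
  `sum_twoPowSubOne_div_totient_le`: `∑_{l=1}^{L} (2^l-1)/φ(2^l-1) ≤ 3e⁷ L`, through
  `selfDivTotient_eq_sum_divisors` (`n/φ(n) = ∑_{d ∣ n} μ²(d)/φ(d)`) and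
  `#{l ≤ L : e(d) ∣ l} = ⌊L/e(d)⌋`.
§5 **`s(N) ≪ N`** (Nathanson's Lemma 7.9 = Pintz–Ruzsa's Lemma 10 up to the constant):
  `primePairsShift`, `primePowTwoQuadruples` (= `s(N)` as a finset of quadruples),
  `card_primePairsShift_le` (off-diagonal fibres through `primePairs_card_le`, with
  `h/φ(h) = 2 (2^l-1)/φ(2^l-1)`, `shift_div_totient_eq`), `card_primePowTwoQuadruples_le`.
§6 **Romanov's theorem** `romanov`: `#{n ≤ N : n = p + 2^k, k ≥ 1} ≥ cN` for `N ≥ N₀`, by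
  `card_sq_le_card_image_mul_card_filter` (Cauchy–Schwarz over fibres), the prime number theorem
  lower bound `Literature.NumberTheory.Sieve.Lichtman2020.eventually_primeCounting_ge`
  (Chebyshev's bound would do) and §5.

## Deviations from the printed proofs

* The weight is `1/φ(d)` rather than Nathanson's `1/d` (his sieve bound, Thm 7.3, carries
  `∏_{p ∣ h}(1 + 1/p)`; the tree's `primePairs_card_le` carries `h/φ(h) = ∏_{p ∣ h}(1 + 1/(p-1))`);
  Pintz–Ruzsa's weight `k(d) = ∏ 1/(p-2)` (matched to `𝔖(h)`) is not treated here.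
* "`E(x) ≪ log x`" is proved by splitting `∑_{p ∣ D(x)} 1/(p-1)` at `p = x²` (Mertens below, a
  counting argument above) instead of "`ω(D) ≪ x²`, Chebyshev, Mertens's formula"; the convergence of
  the series by dyadic blocks instead of partial summation. Constants are explicit and crude
  (`3e⁷`); only `a = 2`.
* In `s(N)` the primes may equal `2` (Pintz–Ruzsa take odd primes), which only enlarges the count.

## References

* N. P. Romanoff, *Über einige Sätze der additiven Zahlentheorie*, Math. Ann. 109 (1934) 668–678.
  [Romanoff1934]
* M. B. Nathanson, *Additive Number Theory: The Classical Bases*, GTM 164, Springer 1996, §7.6: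
  Lemma 7.8, Lemma 7.9, Lemma 7.10, Theorem 7.11 (held copy
  `book:nathanson1996-additive-number-theory`, text chunks 125–128). [Nathanson1996]
* J. Pintz, I. Z. Ruzsa, *On Linnik's approximation to Goldbach's problem, I*, Acta Arith. 109
  (2003) 169–194, §8: (8.2)–(8.4), (8.7)–(8.14), Lemma 10. [PintzRuzsa2003]
-/

noncomputable section

open Finset Filter

namespace Literature.NumberTheory.Sieve.Romanov

/-- `e(d)`: the multiplicative order of `2` modulo `d` (Nathanson's `e(d)` with `a = 2`,
Pintz–Ruzsa's `ρ(d)`); junk value `0` for even `d ≥ 2` (then `2` is not a unit). [cite: Nathanson1996, §7.6 Lemma 7.8] -/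
def ordTwo (d : ℕ) : ℕ := orderOf (2 : ZMod d)

/-- For odd `d`, `2` has positive order modulo `d`. [folklore] -/
theorem ordTwo_pos {d : ℕ} (hd : Odd d) : 0 < ordTwo d := by
  have hd0 : d ≠ 0 := by rintro rfl; exact (Nat.not_odd_zero hd).elim
  haveI : NeZero d := ⟨hd0⟩
  have hcop : Nat.Coprime 2 d := Nat.coprime_two_left.mpr hd
  have h2 : ((ZMod.unitOfCoprime 2 hcop : (ZMod d)ˣ) : ZMod d) = 2 := by
    rw [ZMod.coe_unitOfCoprime]; norm_cast
  unfold ordTwo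
  rw [← h2, orderOf_units]
  exact orderOf_pos _

/-- `d ∣ 2^l - 1 ↔ e(d) ∣ l` for odd `d`. [cite: Nathanson1996, §7.6 (proof of Lemma 7.9)] -/
theorem dvd_two_pow_sub_one_iff {d : ℕ} (l : ℕ) : d ∣ 2 ^ l - 1 ↔ ordTwo d ∣ l := by
  unfold ordTwo
  rw [orderOf_dvd_iff_pow_eq_one, ← ZMod.natCast_eq_zero_iff]
  have h1 : 1 ≤ 2 ^ l := Nat.one_le_two_pow
  push_cast [Nat.cast_sub h1]
  exact sub_eq_zero

/-- `d ∣ 2^{e(d)} - 1`. [folklore] -/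
theorem dvd_two_pow_ordTwo_sub_one (d : ℕ) : d ∣ 2 ^ ordTwo d - 1 :=
  (dvd_two_pow_sub_one_iff _).mpr dvd_rfl

/-- `d ≤ 2^{e(d)} - 1 < 2^{e(d)}` for odd `d`. [folklore] -/
theorem lt_two_pow_ordTwo {d : ℕ} (hd : Odd d) : d < 2 ^ ordTwo d := by
  have h := Nat.le_of_dvd ?_ (dvd_two_pow_ordTwo_sub_one d)
  · have : 1 ≤ 2 ^ ordTwo d := Nat.one_le_two_pow
    omega
  · have := ordTwo_pos hd
    have : 2 ≤ 2 ^ ordTwo d := by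
      calc (2 : ℕ) = 2 ^ 1 := by norm_num
        _ ≤ 2 ^ ordTwo d := Nat.pow_le_pow_right (by norm_num) this
    omega

/-- `e(d) ≤ d`. [folklore] -/
theorem ordTwo_le_self {d : ℕ} (hd : d ≠ 0) : ordTwo d ≤ d := by
  haveI : NeZero d := ⟨hd⟩
  unfold ordTwo
  calc orderOf (2 : ZMod d) ≤ Fintype.card (ZMod d) := orderOf_le_card_univ
    _ = d := ZMod.card d

/-- If `p ∣ d` then `e(p) ∣ e(d)`. [folklore] -/
theorem ordTwo_dvd_ordTwo_of_dvd {p d : ℕ} (h : p ∣ d) : ordTwo p ∣ ordTwo d :=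
  (dvd_two_pow_sub_one_iff _).mp (h.trans (dvd_two_pow_ordTwo_sub_one d))

/-- If `p ∣ d`, `d` odd, then `e(p) ≤ e(d)`. [folklore] -/
theorem ordTwo_le_ordTwo_of_dvd {p d : ℕ} (hd : Odd d) (h : p ∣ d) : ordTwo p ≤ ordTwo d :=
  Nat.le_of_dvd (ordTwo_pos hd) (ordTwo_dvd_ordTwo_of_dvd h)

/-! ### The primes with `e(p) ≤ x` and Romanov's product `D(x) = ∏_{k ≤ x} (2^k - 1)` -/

/-- The odd primes `p` with `e(p) ≤ x`; they all lie below `2^x` (`lt_two_pow_ordTwo`), so this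
finite set is all of them. [cite: Nathanson1996, §7.6 Lemma 7.8 (proof)] -/
def primesOrdLE (x : ℕ) : Finset ℕ :=
  (Finset.range (2 ^ x)).filter fun p => p.Prime ∧ Odd p ∧ ordTwo p ≤ x

/-- Membership in `primesOrdLE x`: exactly the odd primes with `e(p) ≤ x`. [folklore] -/
theorem mem_primesOrdLE {x p : ℕ} : p ∈ primesOrdLE x ↔ p.Prime ∧ Odd p ∧ ordTwo p ≤ x := by
  unfold primesOrdLE
  rw [Finset.mem_filter, Finset.mem_range]
  constructor
  · exact fun h => h.2
  · intro h
    refine ⟨?_, h⟩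
    calc p < 2 ^ ordTwo p := lt_two_pow_ordTwo h.2.1
      _ ≤ 2 ^ x := Nat.pow_le_pow_right (by norm_num) h.2.2

/-- Romanov's `D(x) = ∏_{k=1}^{x} (2^k - 1)`. [cite: Nathanson1996, §7.6 Lemma 7.8 (proof)] -/
def romanovD (x : ℕ) : ℕ := ∏ k ∈ Finset.Icc 1 x, (2 ^ k - 1)

/-- `D(x) ≠ 0`. [folklore] -/
theorem romanovD_ne_zero (x : ℕ) : romanovD x ≠ 0 := by
  unfold romanovD
  rw [Finset.prod_ne_zero_iff]
  intro k hk
  have hk1 : 1 ≤ k := (Finset.mem_Icc.mp hk).1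
  have : 2 ≤ 2 ^ k := by
    calc (2 : ℕ) = 2 ^ 1 := by norm_num
      _ ≤ 2 ^ k := Nat.pow_le_pow_right (by norm_num) hk1
  omega

/-- `D(x) ≤ 2^{x²}` (Nathanson: `D < ∏ a^k ≤ a^{x(x+1)/2} < a^{x²}`). [cite: Nathanson1996, §7.6 Lemma 7.8 (proof)] -/
theorem romanovD_le (x : ℕ) : romanovD x ≤ 2 ^ (x * x) := by
  unfold romanovD
  calc ∏ k ∈ Finset.Icc 1 x, (2 ^ k - 1) ≤ ∏ k ∈ Finset.Icc 1 x, 2 ^ x := by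
        refine Finset.prod_le_prod' fun k hk => ?_
        have hkx : k ≤ x := (Finset.mem_Icc.mp hk).2
        exact (Nat.sub_le _ _).trans (Nat.pow_le_pow_right (by norm_num) hkx)
    _ = 2 ^ (x * x) := by
        rw [Finset.prod_const, Nat.card_Icc, ← pow_mul, Nat.add_sub_cancel]

/-- Every `p ∈ primesOrdLE x` divides `D(x)` (through the factor `2^{e(p)} - 1`), hence so does
their product. [cite: Nathanson1996, §7.6 Lemma 7.8 (proof)] -/
theorem prod_primesOrdLE_dvd (x : ℕ) : ∏ p ∈ primesOrdLE x, p ∣ romanovD x := by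
  refine Finset.prod_primes_dvd (romanovD x) (fun p hp => (mem_primesOrdLE.mp hp).1.prime) ?_
  intro p hp
  obtain ⟨-, hodd, hle⟩ := mem_primesOrdLE.mp hp
  unfold romanovD
  exact (dvd_two_pow_ordTwo_sub_one p).trans
    (Finset.dvd_prod_of_mem _ (Finset.mem_Icc.mpr ⟨ordTwo_pos hodd, hle⟩))

/-- `∏_{p ∈ primesOrdLE x} p ≤ 2^{x²}` (so `ω(D) ≪ x²` in Nathanson's words). [cite: Nathanson1996, §7.6 Lemma 7.8 (proof)] -/
theorem prod_primesOrdLE_le (x : ℕ) : ∏ p ∈ primesOrdLE x, p ≤ 2 ^ (x * x) :=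
  (Nat.le_of_dvd (Nat.pos_of_ne_zero (romanovD_ne_zero x)) (prod_primesOrdLE_dvd x)).trans
    (romanovD_le x)

/-- The primes of `primesOrdLE x` above `y > 1` are few: `#{p > y} · log y ≤ x² log 2`
(`y^{#} ≤ ∏ p ≤ 2^{x²}`). [cite: Nathanson1996, §7.6 Lemma 7.8 (proof)] -/
theorem card_filter_lt_mul_log_le (x : ℕ) {y : ℝ} (hy : 1 < y) :
    (((primesOrdLE x).filter fun p : ℕ => y < (p : ℝ)).card : ℝ) * Real.log y ≤ (x : ℝ) * x * Real.log 2 := by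
  set T := (primesOrdLE x).filter fun p : ℕ => y < (p : ℝ) with hT
  have hy0 : 0 < y := by linarith
  have h1 : y ^ T.card ≤ ∏ p ∈ T, (p : ℝ) := by
    rw [← Finset.prod_const]
    refine Finset.prod_le_prod (fun _ _ => hy0.le) fun p hp => (Finset.mem_filter.mp hp).2.le
  have h2 : ∏ p ∈ T, (p : ℝ) ≤ ∏ p ∈ primesOrdLE x, (p : ℝ) := by
    refine Finset.prod_le_prod_of_subset_of_one_le (Finset.filter_subset _ _)
      (fun p _ => Nat.cast_nonneg p) fun p hp _ => ?_
    exact_mod_cast (mem_primesOrdLE.mp hp).1.one_lt.le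
  have h3 : ∏ p ∈ primesOrdLE x, (p : ℝ) ≤ (2 : ℝ) ^ (x * x) := by
    rw [← Nat.cast_prod]
    exact_mod_cast prod_primesOrdLE_le x
  have h4 : y ^ T.card ≤ (2 : ℝ) ^ (x * x) := h1.trans (h2.trans h3)
  have h5 := Real.log_le_log (by positivity) h4
  rw [Real.log_pow, Real.log_pow] at h5
  push_cast at h5
  linarith

/-- `∑_{p ≤ N} 1/(p - 1) ≤ log log N + 5` (`N ≥ 2`): Mertens' upper bound `∑_{p ≤ N} 1/p ≤ log log N + 4`
(`Literature.NumberTheory.LFunctions.MertensBound.sum_inv_prime_le`) plus `∑_p 1/(p(p-1)) ≤ 1`.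
[cite: Nathanson1996, Thm 6.8 (Mertens's formula)] -/
theorem sum_primesLE_inv_pred_le {N : ℕ} (hN : 2 ≤ N) :
    ∑ p ∈ Nat.primesLE N, 1 / ((p : ℝ) - 1) ≤ Real.log (Real.log N) + 5 := by
  have hsplit : ∑ p ∈ Nat.primesLE N, 1 / ((p : ℝ) - 1) =
      ∑ p ∈ Nat.primesLE N, (1 : ℝ) / p + ∑ p ∈ Nat.primesLE N, (1 : ℝ) / (p * (p - 1)) := by
    rw [← Finset.sum_add_distrib]
    refine Finset.sum_congr rfl fun p hp => ?_
    have hp2 : (2 : ℝ) ≤ p := by exact_mod_cast (Nat.mem_primesLE.mp hp).2.two_le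
    have hp0 : (p : ℝ) ≠ 0 := by positivity
    have hp1 : (p : ℝ) - 1 ≠ 0 := (show (0 : ℝ) < p - 1 by linarith).ne'
    field_simp
    ring
  rw [hsplit]
  linarith [Literature.NumberTheory.LFunctions.MertensBound.sum_inv_prime_le N hN,
    Literature.NumberTheory.LFunctions.MertensBound.sum_inv_prime_mul_pred_le_one N]

/-- **The key estimate of Romanov's lemma**: for `x ≥ 2`,
`∑_{p ∈ primesOrdLE x} 1/(p-1) ≤ log log x + 7` (primes `≤ x²` by Mertens, primes `> x²` are at
most `x² log 2 / log x²` in number and contribute `≤ 1/2`). Nathanson phrases this step as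
`E(x) ≪ ∏_{p ≤ p_n}(1 - 1/p)⁻¹ ≪ log p_n ≪ log x`. [cite: Nathanson1996, §7.6 Lemma 7.8 (proof)] -/
theorem sum_primesOrdLE_inv_pred_le {x : ℕ} (hx : 2 ≤ x) :
    ∑ p ∈ primesOrdLE x, 1 / ((p : ℝ) - 1) ≤ Real.log (Real.log x) + 7 := by
  have hx2 : (2 : ℝ) ≤ x := by exact_mod_cast hx
  have hxpos : (0 : ℝ) < x := by linarith
  have hlogx : Real.log 2 ≤ Real.log x := Real.log_le_log two_pos hx2
  have hl2 : (0.6931471803 : ℝ) < Real.log 2 := Real.log_two_gt_d9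
  have hl2' : Real.log 2 < 0.6931471808 := Real.log_two_lt_d9
  have hlogx0 : 0 < Real.log x := by linarith
  set y : ℝ := (x : ℝ) ^ 2 with hy
  have hy1 : 1 < y := by rw [hy]; nlinarith
  -- split the sum at `y = x²`
  rw [← Finset.sum_filter_add_sum_filter_not (primesOrdLE x) (fun p : ℕ => y < (p : ℝ))]
  -- large primes
  have hlarge : ∑ p ∈ (primesOrdLE x).filter (fun p : ℕ => y < (p : ℝ)), 1 / ((p : ℝ) - 1) ≤ 1 / 2 := by
    have hterm : ∀ p ∈ (primesOrdLE x).filter (fun p : ℕ => y < (p : ℝ)), 1 / ((p : ℝ) - 1) ≤ 1 / y := by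
      intro p hp
      have hyp : y < p := (Finset.mem_filter.mp hp).2
      -- `y = x²` and `p` are integers, so `p ≥ y + 1`
      have hyp' : y + 1 ≤ p := by
        have : ((x ^ 2 : ℕ) : ℝ) < p := by push_cast; rw [hy] at hyp; exact hyp
        have h' : x ^ 2 < p := by exact_mod_cast this
        have : ((x ^ 2 + 1 : ℕ) : ℝ) ≤ p := by exact_mod_cast Nat.succ_le_of_lt h'
        push_cast at this
        rw [hy]; linarith
      have hy0 : 0 < y := by linarith
      exact one_div_le_one_div_of_le hy0 (by linarith)
    calc ∑ p ∈ (primesOrdLE x).filter (fun p : ℕ => y < (p : ℝ)), 1 / ((p : ℝ) - 1)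
        ≤ ∑ p ∈ (primesOrdLE x).filter (fun p : ℕ => y < (p : ℝ)), 1 / y := Finset.sum_le_sum hterm
      _ = (((primesOrdLE x).filter fun p : ℕ => y < (p : ℝ)).card : ℝ) * (1 / y) := by
          rw [Finset.sum_const, nsmul_eq_mul]
      _ ≤ 1 / 2 := by
          have hc := card_filter_lt_mul_log_le x hy1
          have hlogy : Real.log y = 2 * Real.log x := by rw [hy, Real.log_pow]; push_cast; ring
          rw [hlogy] at hc
          -- `card ≤ x² log 2 / (2 log x) ≤ x² / 2`
          have hcard : (((primesOrdLE x).filter fun p : ℕ => y < (p : ℝ)).card : ℝ) ≤ (x : ℝ) * x / 2 := by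
            have : (((primesOrdLE x).filter fun p : ℕ => y < (p : ℝ)).card : ℝ) * (2 * Real.log x) ≤
                (x : ℝ) * x / 2 * (2 * Real.log x) := by nlinarith
            exact le_of_mul_le_mul_right this (by positivity)
          have hy0 : 0 < y := by linarith
          rw [mul_one_div, div_le_iff₀ hy0, hy]
          nlinarith
  -- small primes: a sub-sum of `∑_{p ≤ x²} 1/(p-1)`
  have hsmall : ∑ p ∈ (primesOrdLE x).filter (fun p : ℕ => ¬ y < (p : ℝ)), 1 / ((p : ℝ) - 1) ≤
      Real.log (Real.log x) + Real.log 2 + 5 := by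
    have hsub : (primesOrdLE x).filter (fun p : ℕ => ¬ y < (p : ℝ)) ⊆ Nat.primesLE (x ^ 2) := by
      intro p hp
      rw [Finset.mem_filter] at hp
      rw [Nat.mem_primesLE]
      refine ⟨?_, (mem_primesOrdLE.mp hp.1).1⟩
      have : (p : ℝ) ≤ y := not_lt.mp hp.2
      rw [hy] at this
      exact_mod_cast this
    have hN : 2 ≤ x ^ 2 := by nlinarith
    calc ∑ p ∈ (primesOrdLE x).filter (fun p : ℕ => ¬ y < (p : ℝ)), 1 / ((p : ℝ) - 1)
        ≤ ∑ p ∈ Nat.primesLE (x ^ 2), 1 / ((p : ℝ) - 1) := by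
          refine Finset.sum_le_sum_of_subset_of_nonneg hsub fun p hp _ => ?_
          have hp2 : (2 : ℝ) ≤ p := by exact_mod_cast (Nat.mem_primesLE.mp hp).2.two_le
          have : (0 : ℝ) < p - 1 := by linarith
          positivity
      _ ≤ Real.log (Real.log ((x ^ 2 : ℕ) : ℝ)) + 5 := sum_primesLE_inv_pred_le hN
      _ = Real.log (Real.log x) + Real.log 2 + 5 := by
          push_cast
          rw [Real.log_pow, Nat.cast_ofNat, Real.log_mul two_ne_zero hlogx0.ne']
          ring
  linarith

/-! ### `E(x)`: sums of `1/φ(d)` over square-free `d` with `e(d) ≤ x` -/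

/-- For square-free `d`, `φ(d) = ∏_{p ∣ d} (p - 1)`. [folklore] -/
theorem totient_eq_prod_sub_one_of_squarefree {d : ℕ} (hd : Squarefree d) :
    Nat.totient d = ∏ p ∈ d.primeFactors, (p - 1) := by
  have hd0 : d ≠ 0 := hd.ne_zero
  have h := Nat.totient_mul_prod_primeFactors d
  rw [Nat.prod_primeFactors_of_squarefree hd] at h
  exact Nat.eq_of_mul_eq_mul_right (Nat.pos_of_ne_zero hd0) (h.trans (mul_comm _ _))

/-- **Square-free sums against the Euler product**: if every `d ∈ S` is square-free with all its
prime factors in the set of primes `P`, then `∑_{d ∈ S} 1/φ(d) ≤ ∏_{p ∈ P} (1 + 1/(p-1))`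
(expand the product over subsets of `P`; `d ↦ primeFactors d` is injective on square-free `d`).
Nathanson: `E(x) ≤ ∑_{d ∣ D, μ²(d)=1} 1/d = ∏_{p ∣ D}(1 + 1/p)`, here with `1/φ` in place of `1/d`.
[cite: Nathanson1996, §7.6 Lemma 7.8 (proof)] -/
theorem sum_inv_totient_le_prod {S P : Finset ℕ} (hP : ∀ p ∈ P, p.Prime)
    (hS : ∀ d ∈ S, Squarefree d ∧ d.primeFactors ⊆ P) :
    ∑ d ∈ S, (1 : ℝ) / Nat.totient d ≤ ∏ p ∈ P, (1 + 1 / ((p : ℝ) - 1)) := by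
  classical
  rw [Finset.prod_one_add]
  have hinj : Set.InjOn Nat.primeFactors (S : Set ℕ) := by
    intro d₁ h₁ d₂ h₂ heq
    have e₁ := Nat.prod_primeFactors_of_squarefree (hS d₁ h₁).1
    have e₂ := Nat.prod_primeFactors_of_squarefree (hS d₂ h₂).1
    rw [← e₁, ← e₂]
    exact congrArg (fun t : Finset ℕ => ∏ p ∈ t, p) heq
  have hterm : ∀ d ∈ S, (1 : ℝ) / Nat.totient d = ∏ p ∈ d.primeFactors, 1 / ((p : ℝ) - 1) := by
    intro d hd
    rw [totient_eq_prod_sub_one_of_squarefree (hS d hd).1, Nat.cast_prod, one_div, ← Finset.prod_inv_distrib]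
    refine Finset.prod_congr rfl fun p hp => ?_
    have hp2 : 2 ≤ p := (Nat.prime_of_mem_primeFactors hp).two_le
    rw [one_div, Nat.cast_sub (by omega)]
    norm_num
  calc ∑ d ∈ S, (1 : ℝ) / Nat.totient d = ∑ d ∈ S, ∏ p ∈ d.primeFactors, 1 / ((p : ℝ) - 1) :=
        Finset.sum_congr rfl hterm
    _ = ∑ t ∈ S.image Nat.primeFactors, ∏ p ∈ t, 1 / ((p : ℝ) - 1) := by rw [Finset.sum_image hinj]
    _ ≤ ∑ t ∈ P.powerset, ∏ p ∈ t, 1 / ((p : ℝ) - 1) := by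
        refine Finset.sum_le_sum_of_subset_of_nonneg (fun t ht => ?_) fun t ht _ => ?_
        · obtain ⟨d, hd, rfl⟩ := Finset.mem_image.mp ht
          exact Finset.mem_powerset.mpr (hS d hd).2
        · refine Finset.prod_nonneg fun p hp => ?_
          have hp2 : (2 : ℝ) ≤ p := by exact_mod_cast (hP p (Finset.mem_powerset.mp ht hp)).two_le
          have : (0 : ℝ) < p - 1 := by linarith
          positivity

/-- **`E(x) ≪ log x`** (Nathanson's Lemma 7.8, main step, with `1/φ(d)` in place of `1/d`): for
`x ≥ 2` and any finite set `S` of odd square-free `d` with `e(d) ≤ x`,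
`∑_{d ∈ S} 1/φ(d) ≤ e⁷ log x`. Every prime factor `p` of such a `d` is odd with `e(p) ∣ e(d)`, so
`p ∈ primesOrdLE x`; then `sum_inv_totient_le_prod`, `1 + t ≤ eᵗ` and
`sum_primesOrdLE_inv_pred_le`. [cite: Nathanson1996, §7.6 Lemma 7.8] -/
theorem sum_inv_totient_le_log {x : ℕ} (hx : 2 ≤ x) {S : Finset ℕ}
    (hS : ∀ d ∈ S, Odd d ∧ Squarefree d ∧ ordTwo d ≤ x) :
    ∑ d ∈ S, (1 : ℝ) / Nat.totient d ≤ Real.exp 7 * Real.log x := by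
  have hx2 : (2 : ℝ) ≤ x := by exact_mod_cast hx
  have hlogx0 : 0 < Real.log x := Real.log_pos (by linarith)
  have hP : ∀ p ∈ primesOrdLE x, p.Prime := fun p hp => (mem_primesOrdLE.mp hp).1
  have hS' : ∀ d ∈ S, Squarefree d ∧ d.primeFactors ⊆ primesOrdLE x := by
    intro d hd
    obtain ⟨hodd, hsq, hle⟩ := hS d hd
    refine ⟨hsq, fun p hp => ?_⟩
    have hpp : p.Prime := Nat.prime_of_mem_primeFactors hp
    have hpd : p ∣ d := Nat.dvd_of_mem_primeFactors hp
    exact mem_primesOrdLE.mpr ⟨hpp, hodd.of_dvd_nat hpd, (ordTwo_le_ordTwo_of_dvd hodd hpd).trans hle⟩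
  have h1 := sum_inv_totient_le_prod hP hS'
  have h2 : ∏ p ∈ primesOrdLE x, (1 + 1 / ((p : ℝ) - 1)) ≤
      Real.exp (∑ p ∈ primesOrdLE x, 1 / ((p : ℝ) - 1)) := by
    rw [Real.exp_sum]
    refine Finset.prod_le_prod (fun p hp => ?_) fun p hp => ?_
    · have hp2 : (2 : ℝ) ≤ p := by exact_mod_cast (hP p hp).two_le
      have : (0 : ℝ) < p - 1 := by linarith
      positivity
    · have := Real.add_one_le_exp (1 / ((p : ℝ) - 1))
      linarith
  have h3 : Real.exp (∑ p ∈ primesOrdLE x, 1 / ((p : ℝ) - 1)) ≤ Real.exp 7 * Real.log x := by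
    calc Real.exp (∑ p ∈ primesOrdLE x, 1 / ((p : ℝ) - 1))
        ≤ Real.exp (Real.log (Real.log x) + 7) := Real.exp_le_exp.mpr (sum_primesOrdLE_inv_pred_le hx)
      _ = Real.exp 7 * Real.log x := by rw [Real.exp_add, Real.exp_log hlogx0, mul_comm]
  exact h1.trans (h2.trans h3)

/-! ### Romanov's series `∑ 1/(φ(d) e(d))` -/

/-- `∑_{j < n} (j+1)/2^j = 4 - (2n+4)/2^n ≤ 4`. [folklore] -/
theorem sum_range_succ_div_two_pow_le (n : ℕ) :
    ∑ j ∈ Finset.range n, ((j : ℝ) + 1) / 2 ^ j ≤ 4 := by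
  have h : ∀ n : ℕ, ∑ j ∈ Finset.range n, ((j : ℝ) + 1) / 2 ^ j = 4 - (2 * n + 4) / 2 ^ n := by
    intro n
    induction n with
    | zero => norm_num
    | succ n ih =>
        rw [Finset.sum_range_succ, ih, pow_succ]
        have : (2 : ℝ) ^ n ≠ 0 := pow_ne_zero _ two_ne_zero
        field_simp
        push_cast
        ring
  rw [h n]
  have : 0 ≤ (2 * (n : ℝ) + 4) / 2 ^ n := by positivity
  linarith

/-- **Romanov's lemma** (Romanoff 1934; Nathanson's Lemma 7.8 with `1/φ(d)` for `1/d`, the form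
needed against the sieve bound `≪ h/φ(h)`; Pintz–Ruzsa I (8.13)–(8.14) with the weight `k(d)`):
the series `∑_{d odd, square-free} 1/(φ(d) e(d))` converges; quantitatively every partial sum is
`≤ 3e⁷`. Proof: dyadic decomposition `2^j ≤ e(d) < 2^{j+1}` and `sum_inv_totient_le_log` at
`x = 2^{j+1}` (`∑_j (j+1) log 2 / 2^j = 4 log 2`), in place of Nathanson's partial summation.
[cite: Nathanson1996, §7.6 Lemma 7.8] [cite: Romanoff1934, Satz (Romanov's lemma)] -/
theorem sum_inv_totient_mul_ordTwo_le (S : Finset ℕ) (hS : ∀ d ∈ S, Odd d ∧ Squarefree d) :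
    ∑ d ∈ S, (1 : ℝ) / (Nat.totient d * ordTwo d) ≤ 3 * Real.exp 7 := by
  classical
  -- dyadic index `j(d) = log₂ e(d)`
  set jf : ℕ → ℕ := fun d => Nat.log 2 (ordTwo d) with hjf
  set J : Finset ℕ := S.image jf with hJ
  have hl2 : (0.6931471803 : ℝ) < Real.log 2 := Real.log_two_gt_d9
  have hl2' : Real.log 2 < 0.6931471808 := Real.log_two_lt_d9
  -- pointwise: `1/(φ e) ≤ 2^{-j}/φ`
  have hpt : ∀ d ∈ S, (1 : ℝ) / (Nat.totient d * ordTwo d) ≤ (1 / 2 ^ jf d) * (1 / (Nat.totient d : ℝ)) := by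
    intro d hd
    have hodd := (hS d hd).1
    have he : 0 < ordTwo d := ordTwo_pos hodd
    have hφ : (0 : ℝ) < Nat.totient d := by
      exact_mod_cast Nat.totient_pos.mpr (Nat.pos_of_ne_zero fun h => by simp [h] at hodd)
    have hpow : (2 : ℝ) ^ jf d ≤ ordTwo d := by
      exact_mod_cast Nat.pow_log_le_self 2 he.ne'
    rw [one_div_mul_one_div, one_div_le_one_div (by positivity) (by positivity)]
    nlinarith
  -- fibrewise bound
  have hfib : ∀ j ∈ J, ∑ d ∈ S with jf d = j, (1 / 2 ^ jf d) * (1 / (Nat.totient d : ℝ)) ≤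
      Real.exp 7 * Real.log 2 * (((j : ℝ) + 1) / 2 ^ j) := by
    intro j _
    have hx : 2 ≤ 2 ^ (j + 1) := by
      calc (2 : ℕ) = 2 ^ 1 := by norm_num
        _ ≤ 2 ^ (j + 1) := Nat.pow_le_pow_right (by norm_num) (by omega)
    have hin : ∀ d ∈ S.filter (fun d => jf d = j), Odd d ∧ Squarefree d ∧ ordTwo d ≤ 2 ^ (j + 1) := by
      intro d hd
      rw [Finset.mem_filter] at hd
      refine ⟨(hS d hd.1).1, (hS d hd.1).2, ?_⟩
      have := Nat.lt_pow_succ_log_self (b := 2) (by norm_num) (ordTwo d)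
      rw [← hd.2]
      exact this.le
    have hE := sum_inv_totient_le_log hx hin
    calc ∑ d ∈ S with jf d = j, (1 / 2 ^ jf d) * (1 / (Nat.totient d : ℝ))
        = ∑ d ∈ S with jf d = j, (1 / 2 ^ j) * (1 / (Nat.totient d : ℝ)) := by
          refine Finset.sum_congr rfl fun d hd => ?_
          rw [(Finset.mem_filter.mp hd).2]
      _ = (1 / 2 ^ j) * ∑ d ∈ S with jf d = j, (1 / (Nat.totient d : ℝ)) := by rw [Finset.mul_sum]
      _ ≤ (1 / 2 ^ j) * (Real.exp 7 * Real.log ((2 ^ (j + 1) : ℕ) : ℝ)) :=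
          mul_le_mul_of_nonneg_left hE (by positivity)
      _ = Real.exp 7 * Real.log 2 * (((j : ℝ) + 1) / 2 ^ j) := by
          push_cast
          rw [Real.log_pow]
          push_cast
          ring
  -- assemble
  have hJsub : J ⊆ Finset.range (J.sup id + 1) := fun j hj =>
    Finset.mem_range.mpr (Nat.lt_succ_of_le (Finset.le_sup (f := id) hj))
  calc ∑ d ∈ S, (1 : ℝ) / (Nat.totient d * ordTwo d)
      ≤ ∑ d ∈ S, (1 / 2 ^ jf d) * (1 / (Nat.totient d : ℝ)) := Finset.sum_le_sum hpt
    _ = ∑ j ∈ J, ∑ d ∈ S with jf d = j, (1 / 2 ^ jf d) * (1 / (Nat.totient d : ℝ)) := by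
        rw [Finset.sum_fiberwise_of_maps_to (fun d hd => Finset.mem_image_of_mem jf hd)]
    _ ≤ ∑ j ∈ J, Real.exp 7 * Real.log 2 * (((j : ℝ) + 1) / 2 ^ j) := Finset.sum_le_sum hfib
    _ ≤ ∑ j ∈ Finset.range (J.sup id + 1), Real.exp 7 * Real.log 2 * (((j : ℝ) + 1) / 2 ^ j) :=
        Finset.sum_le_sum_of_subset_of_nonneg hJsub fun j _ _ => by positivity
    _ = Real.exp 7 * Real.log 2 * ∑ j ∈ Finset.range (J.sup id + 1), ((j : ℝ) + 1) / 2 ^ j := by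
        rw [Finset.mul_sum]
    _ ≤ Real.exp 7 * Real.log 2 * 4 :=
        mul_le_mul_of_nonneg_left (sum_range_succ_div_two_pow_le _) (by positivity)
    _ ≤ 3 * Real.exp 7 := by nlinarith [Real.exp_pos 7]

/-! ### `n/φ(n) = ∑_{d ∣ n} μ²(d)/φ(d)` and the sum over `2^l - 1` -/

/-- `μ²(n)/φ(n)` as a real arithmetic function. [folklore] -/
def moebiusSqDivTotient : ArithmeticFunction ℝ :=
  ⟨fun n => if n ≠ 0 ∧ Squarefree n then 1 / (n.totient : ℝ) else 0, by simp⟩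

/-- Unfolding `μ²/φ`. [folklore] -/
theorem moebiusSqDivTotient_apply (n : ℕ) :
    moebiusSqDivTotient n = if n ≠ 0 ∧ Squarefree n then 1 / (n.totient : ℝ) else 0 := rfl

/-- `μ²/φ` is multiplicative. [folklore] -/
theorem isMultiplicative_moebiusSqDivTotient : moebiusSqDivTotient.IsMultiplicative := by
  refine ArithmeticFunction.IsMultiplicative.iff_ne_zero.2 ⟨?_, ?_⟩
  · rw [moebiusSqDivTotient_apply, if_pos ⟨one_ne_zero, squarefree_one⟩]; simp
  · intro m n hm hn hmn
    have hmn0 : m * n ≠ 0 := Nat.mul_ne_zero hm hn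
    simp only [moebiusSqDivTotient_apply, ne_eq, hmn0, not_false_eq_true, true_and, hm, hn,
      Nat.squarefree_mul_iff, Nat.totient_mul hmn, Nat.cast_mul]
    by_cases h1 : Squarefree m <;> by_cases h2 : Squarefree n <;> simp [h1, h2, hmn, mul_comm]

/-- `n ↦ n/φ(n)` as a real arithmetic function. [folklore] -/
def selfDivTotient : ArithmeticFunction ℝ :=
  ⟨fun n => (n : ℝ) / n.totient, by simp⟩

/-- Unfolding `n/φ(n)`. [folklore] -/
theorem selfDivTotient_apply (n : ℕ) : selfDivTotient n = (n : ℝ) / n.totient := rfl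

/-- `n/φ(n)` is multiplicative. [folklore] -/
theorem isMultiplicative_selfDivTotient : selfDivTotient.IsMultiplicative := by
  refine ⟨by simp [selfDivTotient_apply], fun {m n} hmn => ?_⟩
  simp only [selfDivTotient_apply, Nat.cast_mul, Nat.totient_mul hmn]
  rw [mul_div_mul_comm]

/-- **`n/φ(n) = ∑_{d ∣ n} μ²(d)/φ(d)`** (both sides are multiplicative and agree on prime
powers: `p/(p-1) = 1 + 1/(p-1)`). This is the identity behind Nathanson's
`∏_{p ∣ h}(1 + 1/p) … ∑_{d ∣ (a^k-1)} 1/d`, in the `φ`-weighted form. [folklore] -/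
theorem selfDivTotient_eq_sum_divisors (n : ℕ) :
    (n : ℝ) / n.totient = ∑ d ∈ n.divisors, moebiusSqDivTotient d := by
  have hζ : ((ArithmeticFunction.zeta : ArithmeticFunction ℕ) : ArithmeticFunction ℝ).IsMultiplicative :=
    ArithmeticFunction.isMultiplicative_zeta.natCast
  have hmul := isMultiplicative_moebiusSqDivTotient.mul hζ
  have heq : selfDivTotient = moebiusSqDivTotient * (ArithmeticFunction.zeta : ArithmeticFunction ℕ) := by
    rw [ArithmeticFunction.IsMultiplicative.eq_iff_eq_on_prime_powers _ isMultiplicative_selfDivTotient _ hmul]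
    intro p k hp
    rw [ArithmeticFunction.coe_mul_zeta_apply, Nat.sum_divisors_prime_pow hp, selfDivTotient_apply]
    have hp2 : (2 : ℝ) ≤ p := by exact_mod_cast hp.two_le
    have hp1 : (p : ℝ) - 1 ≠ 0 := by
      have : (0 : ℝ) < p - 1 := by linarith
      exact this.ne'
    rcases Nat.eq_zero_or_pos k with rfl | hk
    · simp [moebiusSqDivTotient_apply]
    · -- left side `p^k/φ(p^k) = p/(p-1)`
      have hl : ((p ^ k : ℕ) : ℝ) / (p ^ k).totient = (p : ℝ) / (p - 1) := by
        rw [Nat.totient_prime_pow hp hk]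
        push_cast [Nat.cast_sub hp.one_le]
        have hpk : (p : ℝ) ^ (k - 1) ≠ 0 := pow_ne_zero _ (by positivity)
        have hpow : (p : ℝ) ^ k = p ^ (k - 1) * p := by
          rw [← pow_succ]; congr 1; omega
        rw [hpow]
        field_simp
      rw [hl]
      -- right side: only `j = 0, 1` contribute
      rw [Finset.sum_range_succ', pow_zero]
      have hval : ∀ j ∈ Finset.range k, moebiusSqDivTotient (p ^ (j + 1)) =
          if j = 0 then 1 / ((p : ℝ) - 1) else 0 := by
        intro j _
        rw [moebiusSqDivTotient_apply]
        rcases Nat.eq_zero_or_pos j with rfl | hj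
        · simp [hp.ne_zero, hp.squarefree, Nat.totient_prime hp, Nat.cast_sub hp.one_le]
        · have hns : ¬ Squarefree (p ^ (j + 1)) := by
            rw [Nat.squarefree_pow_iff hp.ne_one (by omega)]
            rintro ⟨-, h⟩; omega
          simp [hns, hj.ne']
      rw [Finset.sum_congr rfl hval, Finset.sum_ite_eq' (Finset.range k) 0, if_pos (Finset.mem_range.mpr hk)]
      rw [moebiusSqDivTotient_apply, if_pos ⟨one_ne_zero, squarefree_one⟩]
      simp only [Nat.totient_one, Nat.cast_one, div_one]
      field_simp
      ring
  have := congrArg (fun f : ArithmeticFunction ℝ => f n) heq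
  simp only [selfDivTotient_apply, ArithmeticFunction.coe_mul_zeta_apply] at this
  exact this

/-- **Romanov's lemma, summed form** (the last display of Nathanson's proof of Lemma 7.9, with
`φ`-weights; Pintz–Ruzsa I (8.11)–(8.13): `F(L) ≤ ∑'_{d ≤ 2^L} k(d)/ρ(d)`): for every `L`,
`∑_{l=1}^{L} (2^l - 1)/φ(2^l - 1) ≤ 3e⁷ · L`. Proof: expand `n/φ(n)` over square-free divisors,
swap sums, `#{l ≤ L : d ∣ 2^l - 1} = #{l ≤ L : e(d) ∣ l} = ⌊L/e(d)⌋`, and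
`sum_inv_totient_mul_ordTwo_le`. [cite: Nathanson1996, §7.6 Lemma 7.9 (proof)] -/
theorem sum_twoPowSubOne_div_totient_le (L : ℕ) :
    ∑ l ∈ Finset.Icc 1 L, (((2 ^ l - 1 : ℕ) : ℝ) / (2 ^ l - 1 : ℕ).totient) ≤ 3 * Real.exp 7 * L := by
  classical
  -- the odd square-free numbers below `2^L`
  set D : Finset ℕ := (Finset.range (2 ^ L)).filter fun d => Odd d ∧ Squarefree d with hD
  have hD' : ∀ d ∈ D, Odd d ∧ Squarefree d := fun d hd => (Finset.mem_filter.mp hd).2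
  -- Step 1: expand each term over square-free divisors, as a sum over `D`
  have hstep1 : ∀ l ∈ Finset.Icc 1 L, (((2 ^ l - 1 : ℕ) : ℝ) / (2 ^ l - 1 : ℕ).totient) =
      ∑ d ∈ D, if d ∣ 2 ^ l - 1 then 1 / (d.totient : ℝ) else 0 := by
    intro l hl
    obtain ⟨hl1, hlL⟩ := Finset.mem_Icc.mp hl
    have hn0 : 2 ^ l - 1 ≠ 0 := by
      have : 2 ≤ 2 ^ l := by
        calc (2 : ℕ) = 2 ^ 1 := by norm_num
          _ ≤ 2 ^ l := Nat.pow_le_pow_right (by norm_num) hl1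
      omega
    have hodd : Odd (2 ^ l - 1) := by
      have : Even (2 ^ l) := (Nat.even_pow' (by omega)).mpr even_two
      rcases this with ⟨m, hm⟩
      exact ⟨m - 1, by omega⟩
    rw [selfDivTotient_eq_sum_divisors (2 ^ l - 1)]
    -- restrict the divisor sum to square-free divisors and re-index inside `D`
    rw [← Finset.sum_filter]
    symm
    refine Finset.sum_subset_zero_on_sdiff ?_ ?_ ?_
    · intro d hd
      rw [Finset.mem_filter] at hd
      rw [Nat.mem_divisors]
      exact ⟨hd.2, hn0⟩
    · intro d hd
      rw [Finset.mem_sdiff, Nat.mem_divisors, Finset.mem_filter, not_and'] at hd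
      have hdvd := hd.1.1
      -- `d ∣ 2^l - 1` but `d ∉ D` with this property: then `d` is not square-free
      have hnD : d ∉ D := hd.2 hdvd
      rw [moebiusSqDivTotient_apply, if_neg]
      rintro ⟨hd0, hsq⟩
      apply hnD
      rw [hD, Finset.mem_filter, Finset.mem_range]
      refine ⟨?_, hodd.of_dvd_nat hdvd, hsq⟩
      calc d ≤ 2 ^ l - 1 := Nat.le_of_dvd (Nat.pos_of_ne_zero hn0) hdvd
        _ < 2 ^ l := Nat.sub_lt (by positivity) one_pos
        _ ≤ 2 ^ L := Nat.pow_le_pow_right (by norm_num) hlL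
    · intro d hd
      rw [Finset.mem_filter] at hd
      have hd0 : d ≠ 0 := by
        rintro rfl
        exact hn0 (Nat.eq_zero_of_zero_dvd hd.2)
      rw [moebiusSqDivTotient_apply, if_pos ⟨hd0, (hD' d hd.1).2⟩]
  -- Step 2: swap the sums and count `l` with `e(d) ∣ l`
  have hcount : ∀ d ∈ D, ∑ l ∈ Finset.Icc 1 L, (if d ∣ 2 ^ l - 1 then 1 / (d.totient : ℝ) else 0) =
      ((L / ordTwo d : ℕ) : ℝ) * (1 / (d.totient : ℝ)) := by
    intro d hd
    rw [← Finset.sum_filter, Finset.sum_const, nsmul_eq_mul]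
    congr 2
    have : (Finset.Icc 1 L).filter (fun l => d ∣ 2 ^ l - 1) = (Finset.Ioc 0 L).filter (fun l => ordTwo d ∣ l) := by
      ext l
      simp only [Finset.mem_filter, Finset.mem_Icc, Finset.mem_Ioc, dvd_two_pow_sub_one_iff]
      omega
    rw [this, Nat.Ioc_filter_dvd_card_eq_div]
  calc ∑ l ∈ Finset.Icc 1 L, (((2 ^ l - 1 : ℕ) : ℝ) / (2 ^ l - 1 : ℕ).totient)
      = ∑ l ∈ Finset.Icc 1 L, ∑ d ∈ D, (if d ∣ 2 ^ l - 1 then 1 / (d.totient : ℝ) else 0) :=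
        Finset.sum_congr rfl hstep1
    _ = ∑ d ∈ D, ∑ l ∈ Finset.Icc 1 L, (if d ∣ 2 ^ l - 1 then 1 / (d.totient : ℝ) else 0) :=
        Finset.sum_comm
    _ = ∑ d ∈ D, ((L / ordTwo d : ℕ) : ℝ) * (1 / (d.totient : ℝ)) := Finset.sum_congr rfl hcount
    _ ≤ ∑ d ∈ D, (L : ℝ) * (1 / ((d.totient : ℝ) * ordTwo d)) := by
        refine Finset.sum_le_sum fun d hd => ?_
        have he : 0 < ordTwo d := ordTwo_pos (hD' d hd).1
        have he' : (0 : ℝ) < ordTwo d := by exact_mod_cast he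
        have hφ : (0 : ℝ) ≤ d.totient := Nat.cast_nonneg _
        calc ((L / ordTwo d : ℕ) : ℝ) * (1 / (d.totient : ℝ))
            ≤ ((L : ℝ) / ordTwo d) * (1 / (d.totient : ℝ)) :=
              mul_le_mul_of_nonneg_right (Nat.cast_div_le) (by positivity)
          _ = (L : ℝ) * (1 / ((d.totient : ℝ) * ordTwo d)) := by
              field_simp
    _ = (L : ℝ) * ∑ d ∈ D, 1 / ((d.totient : ℝ) * ordTwo d) := by rw [Finset.mul_sum]
    _ ≤ (L : ℝ) * (3 * Real.exp 7) :=
        mul_le_mul_of_nonneg_left (sum_inv_totient_mul_ordTwo_le D hD') (Nat.cast_nonneg L)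
    _ = 3 * Real.exp 7 * L := by ring

/-! ### The Pintz–Ruzsa count `s(N)` -/

/-- The prime pairs `(p₁, p₂)`, `pᵢ ≤ N`, with `p₁ + 2^{m₁} = p₂ + 2^{m₂}` (i.e.
`p₁ - p₂ = 2^{m₂} - 2^{m₁}`), for fixed exponents. [cite: PintzRuzsa2003, §8 (8.2)] -/
def primePairsShift (N m₁ m₂ : ℕ) : Finset (ℕ × ℕ) :=
  (Nat.primesLE N ×ˢ Nat.primesLE N).filter fun q => q.1 + 2 ^ m₁ = q.2 + 2 ^ m₂

/-- Pintz–Ruzsa's `s(N) = #{(p₁, p₂, m₁, m₂) : p₁ - p₂ = 2^{m₂} - 2^{m₁}, pⱼ ≤ N, 1 ≤ mⱼ ≤ L}`,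
`L = ⌊log₂ N⌋` ((8.2); here the primes `pⱼ` may also be `2`, which only enlarges the count), as
the set of quadruples `((p₁, p₂), (m₁, m₂))`. By (8.3)–(8.4) this is `∑_n r₁(n)² = ∫₀¹ |S(α)G(α)|² dα`.
[cite: PintzRuzsa2003, §8 (8.2)] -/
def primePowTwoQuadruples (N : ℕ) : Finset ((ℕ × ℕ) × (ℕ × ℕ)) :=
  ((Nat.primesLE N ×ˢ Nat.primesLE N) ×ˢ
      (Finset.Icc 1 (Nat.log 2 N) ×ˢ Finset.Icc 1 (Nat.log 2 N))).filter
    fun x => x.1.1 + 2 ^ x.2.1 = x.1.2 + 2 ^ x.2.2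

/-- `s(N)` fibred over the exponent pairs. [folklore] -/
theorem card_primePowTwoQuadruples_eq_sum (N : ℕ) :
    (primePowTwoQuadruples N).card =
      ∑ m ∈ Finset.Icc 1 (Nat.log 2 N) ×ˢ Finset.Icc 1 (Nat.log 2 N), (primePairsShift N m.1 m.2).card := by
  unfold primePowTwoQuadruples primePairsShift
  rw [Finset.card_filter, Finset.sum_product_right]
  refine Finset.sum_congr rfl fun m _ => ?_
  rw [Finset.card_filter]

/-- Symmetry `(p₁, p₂, m₁, m₂) ↔ (p₂, p₁, m₂, m₁)`. [folklore] -/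
theorem card_primePairsShift_comm (N m₁ m₂ : ℕ) :
    (primePairsShift N m₁ m₂).card = (primePairsShift N m₂ m₁).card := by
  refine Finset.card_nbij' Prod.swap Prod.swap (fun q hq => ?_) (fun q hq => ?_) (fun _ _ => rfl) fun _ _ => rfl
  · simp only [primePairsShift, Finset.mem_coe, Finset.mem_filter, Finset.mem_product] at hq ⊢
    exact ⟨⟨hq.1.2, hq.1.1⟩, hq.2.symm⟩
  · simp only [primePairsShift, Finset.mem_coe, Finset.mem_filter, Finset.mem_product] at hq ⊢
    exact ⟨⟨hq.1.2, hq.1.1⟩, hq.2.symm⟩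

/-- The diagonal `m₁ = m₂` forces `p₁ = p₂`: at most `π(N)` pairs. [cite: PintzRuzsa2003, §8 (8.7) (`R(0) = π(N)`)] -/
theorem card_primePairsShift_self_le (N m : ℕ) :
    (primePairsShift N m m).card ≤ (Nat.primesLE N).card := by
  refine Finset.card_le_card_of_injOn Prod.fst (fun q hq => ?_) fun q hq q' hq' h => ?_
  · simp only [primePairsShift, Finset.mem_coe, Finset.mem_filter, Finset.mem_product] at hq
    exact hq.1.1
  · simp only [primePairsShift, Finset.mem_coe, Finset.mem_filter, Finset.mem_product] at hq hq'
    have h1 : q.1 = q.2 := by have := hq.2; omega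
    have h2 : q'.1 = q'.2 := by have := hq'.2; omega
    exact Prod.ext h (by rw [← h1, ← h2]; exact h)

/-- `g(l) = (2^l - 1)/φ(2^l - 1)`, the weight of Romanov's lemma. [folklore] -/
def romanovWeight (l : ℕ) : ℝ := ((2 ^ l - 1 : ℕ) : ℝ) / ((2 ^ l - 1 : ℕ).totient : ℝ)

/-- `g(l) ≥ 0`. [folklore] -/
theorem romanovWeight_nonneg (l : ℕ) : 0 ≤ romanovWeight l := by
  unfold romanovWeight; positivity

/-- `h/φ(h) = 2 g(l)` for `h = 2^{m₁}(2^l - 1)`, `m₁, l ≥ 1`. [folklore] -/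
theorem shift_div_totient_eq {m₁ l : ℕ} (hm₁ : 1 ≤ m₁) (hl : 1 ≤ l) :
    ((2 ^ m₁ * (2 ^ l - 1) : ℕ) : ℝ) / ((2 ^ m₁ * (2 ^ l - 1) : ℕ).totient : ℝ) = 2 * romanovWeight l := by
  have hodd : Odd (2 ^ l - 1) := by
    have : Even (2 ^ l) := (Nat.even_pow' (by omega)).mpr even_two
    rcases this with ⟨k, hk⟩
    exact ⟨k - 1, by have : 1 ≤ 2 ^ l := Nat.one_le_two_pow; omega⟩
  have hcop : Nat.Coprime (2 ^ m₁) (2 ^ l - 1) :=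
    Nat.Coprime.pow_left _ (Nat.coprime_two_left.mpr hodd)
  have hn1 : 1 ≤ 2 ^ l - 1 := by
    have : 2 ≤ 2 ^ l := by
      calc (2 : ℕ) = 2 ^ 1 := by norm_num
        _ ≤ 2 ^ l := Nat.pow_le_pow_right (by norm_num) hl
    omega
  have hφpos : 0 < (2 ^ l - 1).totient := Nat.totient_pos.mpr (by omega)
  rw [Nat.totient_mul hcop, Nat.totient_prime_pow Nat.prime_two (by omega)]
  unfold romanovWeight
  have h2 : (2 : ℝ) ^ m₁ = 2 * 2 ^ (m₁ - 1) := by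
    rw [← pow_succ']; congr 1; omega
  have hφ : (0 : ℝ) < ((2 ^ l - 1).totient : ℝ) := by exact_mod_cast hφpos
  push_cast
  rw [h2]
  field_simp

/-- **The off-diagonal fibres through the prime-pair sieve**: for `1 ≤ m₁ < m₂ ≤ L = ⌊log₂ N⌋`
the pairs with `p₁ - p₂ = h := 2^{m₂} - 2^{m₁}` inject (`(p₁,p₂) ↦ p₂`) into
`{p ≤ N : p + h prime}`, which has `≤ C₁ (h/φ(h)) N/log² N = 2C₁ g(m₂ - m₁) N/log² N` elements by
the upper-bound sieve `Literature.NumberTheory.Sieve.primePairs_card_le` (Pintz–Ruzsa use Chen's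
theorem, their Lemma 3, with the sharp constant instead). [cite: PintzRuzsa2003, §8 (8.7)] -/
theorem card_primePairsShift_le {C₁ : ℝ}
    (hC₁ : ∀ N h : ℕ, 1 ≤ h → h ≤ N → 2 ≤ N →
      (((Nat.primesLE N).filter fun p => (p + h).Prime).card : ℝ) ≤
        C₁ * (((h : ℝ) / Nat.totient h) * ((N : ℝ) / Real.log N ^ 2)))
    {N m₁ m₂ : ℕ} (hN : 2 ≤ N) (hm₁ : 1 ≤ m₁) (h12 : m₁ < m₂) (hm₂ : m₂ ≤ Nat.log 2 N) :
    ((primePairsShift N m₁ m₂).card : ℝ) ≤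
      C₁ * (2 * romanovWeight (m₂ - m₁)) * ((N : ℝ) / Real.log N ^ 2) := by
  obtain ⟨l, rfl⟩ : ∃ l, m₂ = m₁ + l := ⟨m₂ - m₁, by omega⟩
  have hl : 1 ≤ l := by omega
  set h : ℕ := 2 ^ m₁ * (2 ^ l - 1) with hh
  have hpow : 2 ^ (m₁ + l) = 2 ^ m₁ * 2 ^ l := pow_add 2 m₁ l
  have h2l : 2 ≤ 2 ^ l := by
    calc (2 : ℕ) = 2 ^ 1 := by norm_num
      _ ≤ 2 ^ l := Nat.pow_le_pow_right (by norm_num) hl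
  have hhval : h + 2 ^ m₁ = 2 ^ (m₁ + l) := by
    rw [hh, hpow, Nat.mul_sub, mul_one]
    have : 2 ^ m₁ ≤ 2 ^ m₁ * 2 ^ l := Nat.le_mul_of_pos_right _ (by positivity)
    omega
  have h1 : 1 ≤ h := by
    rw [hh]; exact Nat.le_mul_of_pos_right _ (by omega) |>.trans' Nat.one_le_two_pow
  have hN0 : N ≠ 0 := by omega
  have hhN : h ≤ N := by
    calc h ≤ h + 2 ^ m₁ := Nat.le_add_right _ _
      _ = 2 ^ (m₁ + l) := hhval
      _ ≤ 2 ^ Nat.log 2 N := Nat.pow_le_pow_right (by norm_num) hm₂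
      _ ≤ N := Nat.pow_log_le_self 2 hN0
  -- the injection `(p₁, p₂) ↦ p₂`
  have hcard : (primePairsShift N m₁ (m₁ + l)).card ≤ ((Nat.primesLE N).filter fun p => (p + h).Prime).card := by
    refine Finset.card_le_card_of_injOn Prod.snd (fun q hq => ?_) fun q hq q' hq' heq => ?_
    · simp only [primePairsShift, Finset.mem_coe, Finset.mem_filter, Finset.mem_product] at hq
      rw [Finset.mem_coe, Finset.mem_filter]
      refine ⟨hq.1.2, ?_⟩
      have : q.2 + h = q.1 := by have := hq.2; omega
      rw [this]
      exact (Nat.mem_primesLE.mp hq.1.1).2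
    · simp only [primePairsShift, Finset.mem_coe, Finset.mem_filter, Finset.mem_product] at hq hq'
      have e1 : q.1 = q.2 + h := by have := hq.2; omega
      have e2 : q'.1 = q'.2 + h := by have := hq'.2; omega
      exact Prod.ext (by rw [e1, e2]; simpa using heq) heq
  calc ((primePairsShift N m₁ (m₁ + l)).card : ℝ)
      ≤ (((Nat.primesLE N).filter fun p => (p + h).Prime).card : ℝ) := by exact_mod_cast hcard
    _ ≤ C₁ * (((h : ℝ) / Nat.totient h) * ((N : ℝ) / Real.log N ^ 2)) := hC₁ N h h1 hhN hN
    _ = C₁ * (2 * romanovWeight (m₁ + l - m₁)) * ((N : ℝ) / Real.log N ^ 2) := by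
        rw [Nat.add_sub_cancel_left, hh, shift_div_totient_eq hm₁ hl]
        ring

/-- Fibres of size `≤ 2`: `∑_{a ∈ s} f(g(a)) ≤ 2 ∑_{l ∈ t} f(l)` when `g` maps `s` into `t` with at
most two points in each fibre and `f ≥ 0` on `t`. [folklore] -/
theorem sum_comp_le_two_mul_sum {s t : Finset ℕ} (g : ℕ → ℕ) (f : ℕ → ℝ)
    (hf : ∀ l ∈ t, 0 ≤ f l) (hmaps : ∀ a ∈ s, g a ∈ t)
    (hfib : ∀ l ∈ t, (s.filter fun a => g a = l).card ≤ 2) :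
    ∑ a ∈ s, f (g a) ≤ 2 * ∑ l ∈ t, f l := by
  rw [← Finset.sum_fiberwise_of_maps_to hmaps, Finset.mul_sum]
  refine Finset.sum_le_sum fun l hl => ?_
  calc ∑ a ∈ s with g a = l, f (g a) = ∑ a ∈ s with g a = l, f l :=
        Finset.sum_congr rfl fun a ha => by rw [(Finset.mem_filter.mp ha).2]
    _ = ((s.filter fun a => g a = l).card : ℝ) * f l := by rw [Finset.sum_const, nsmul_eq_mul]
    _ ≤ 2 * f l := by
        have : ((s.filter fun a => g a = l).card : ℝ) ≤ 2 := by exact_mod_cast hfib l hl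
        exact mul_le_mul_of_nonneg_right this (hf l hl)

/-- `L = ⌊log₂ N⌋ ≤ log N / log 2`. [folklore] -/
theorem natLog_two_le_log_div {N : ℕ} (hN : N ≠ 0) :
    (Nat.log 2 N : ℝ) ≤ Real.log N / Real.log 2 := by
  have h := Nat.pow_log_le_self 2 hN
  have h' : (2 : ℝ) ^ Nat.log 2 N ≤ N := by exact_mod_cast h
  have hlog := Real.log_le_log (by positivity) h'
  rw [Real.log_pow] at hlog
  rw [le_div_iff₀ (Real.log_pos one_lt_two)]
  linarith

/-- **Pintz–Ruzsa I, Lemma 10 (order of magnitude) = Nathanson's Lemma 7.9 for `a = 2`**: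
`s(N) = #{(p₁, p₂, m₁, m₂) : p₁ - p₂ = 2^{m₂} - 2^{m₁}, pⱼ ≤ N, 1 ≤ mⱼ ≤ ⌊log₂ N⌋} ≤ C · N` for an
absolute `C` and all `N ≥ 2`. Pintz–Ruzsa prove the sharp form `s(N) ≤ (2C₂/log² 2) N`,
`C₂ < 5.3636`, from Chen's constant `3.9171` and `R₀ < 1.94`; here the unspecified-constant sieve
bound `Literature.NumberTheory.Sieve.primePairs_card_le` and Romanov's lemma
`sum_twoPowSubOne_div_totient_le` give the order of magnitude, exactly as in Nathanson's proof:
diagonal `≤ L π(N) ≤ 6N/log 2`, off-diagonal `≤ 4C₁ (N/log² N) L ∑_{l ≤ L} g(l) ≤ 12e⁷C₁ N L²/log² N`.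
[cite: Nathanson1996, §7.6 Lemma 7.9] [cite: PintzRuzsa2003, §8 Lemma 10] -/
theorem card_primePowTwoQuadruples_le :
    ∃ C : ℝ, ∀ N : ℕ, 2 ≤ N → ((primePowTwoQuadruples N).card : ℝ) ≤ C * N := by
  obtain ⟨C₀, hC₀⟩ := Literature.NumberTheory.Sieve.primePairs_card_le
  -- a nonnegative sieve constant
  set C₁ : ℝ := max C₀ 0 with hC₁def
  have hC₁0 : 0 ≤ C₁ := le_max_right _ _
  have hC₁ : ∀ N h : ℕ, 1 ≤ h → h ≤ N → 2 ≤ N →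
      (((Nat.primesLE N).filter fun p => (p + h).Prime).card : ℝ) ≤
        C₁ * (((h : ℝ) / Nat.totient h) * ((N : ℝ) / Real.log N ^ 2)) := by
    intro N h h1 hhN hN
    refine (hC₀ N h h1 hhN hN).trans (mul_le_mul_of_nonneg_right (le_max_left _ _) ?_)
    positivity
  set K : ℝ := 3 * Real.exp 7 with hK
  have hK0 : 0 ≤ K := by positivity
  refine ⟨18 + 9 * C₁ * K, fun N hN => ?_⟩
  have hN0 : N ≠ 0 := by omega
  have hN2 : (2 : ℝ) ≤ N := by exact_mod_cast hN
  have hNpos : (0 : ℝ) < N := by linarith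
  have hl2 : (0.6931471803 : ℝ) < Real.log 2 := Real.log_two_gt_d9
  have hlogN : Real.log 2 ≤ Real.log N := Real.log_le_log two_pos hN2
  have hlogN0 : 0 < Real.log N := by linarith
  set L : ℕ := Nat.log 2 N with hLdef
  have hL : (L : ℝ) ≤ Real.log N / Real.log 2 := natLog_two_le_log_div hN0
  have hL' : (L : ℝ) * Real.log 2 ≤ Real.log N := by rwa [le_div_iff₀ (by linarith)] at hL
  -- the fibre bound `B`
  set W : ℝ := (N : ℝ) / Real.log N ^ 2 with hW
  have hW0 : 0 ≤ W := by positivity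
  set B : ℕ → ℝ := fun l => if l = 0 then ((Nat.primesLE N).card : ℝ) else C₁ * (2 * romanovWeight l) * W
    with hBdef
  have hB0 : ∀ l, 0 ≤ B l := by
    intro l; simp only [hBdef]
    split_ifs
    · positivity
    · have := romanovWeight_nonneg l; positivity
  have hfibre : ∀ m ∈ Finset.Icc 1 L ×ˢ Finset.Icc 1 L,
      ((primePairsShift N m.1 m.2).card : ℝ) ≤ B (Nat.dist m.1 m.2) := by
    rintro ⟨m₁, m₂⟩ hm
    simp only [Finset.mem_product, Finset.mem_Icc] at hm
    rcases lt_trichotomy m₁ m₂ with h12 | rfl | h21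
    · have hd : Nat.dist m₁ m₂ = m₂ - m₁ := Nat.dist_eq_sub_of_le h12.le
      have hne : m₂ - m₁ ≠ 0 := by omega
      simp only [hBdef, hd, if_neg hne]
      exact card_primePairsShift_le hC₁ hN hm.1.1 h12 hm.2.2
    · simp only [hBdef, Nat.dist_self, if_true]
      exact_mod_cast card_primePairsShift_self_le N m₁
    · have hd : Nat.dist m₁ m₂ = m₁ - m₂ := Nat.dist_eq_sub_of_le_right h21.le
      have hne : m₁ - m₂ ≠ 0 := by omega
      simp only [hBdef, hd, if_neg hne]
      rw [card_primePairsShift_comm]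
      exact card_primePairsShift_le hC₁ hN hm.2.1 h21 hm.1.2
  -- summing `B` over one row
  have hrow : ∀ m₁ ∈ Finset.Icc 1 L,
      ∑ m₂ ∈ Finset.Icc 1 L, B (Nat.dist m₁ m₂) ≤ 2 * ∑ l ∈ Finset.range (L + 1), B l := by
    intro m₁ hm₁
    refine sum_comp_le_two_mul_sum (fun m₂ => Nat.dist m₁ m₂) B (fun l _ => hB0 l) ?_ ?_
    · intro m₂ hm₂
      rw [Finset.mem_Icc] at hm₁ hm₂
      rw [Finset.mem_range]
      unfold Nat.dist; omega
    · intro l _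
      have hsub : (Finset.Icc 1 L).filter (fun m₂ => Nat.dist m₁ m₂ = l) ⊆ {m₁ + l, m₁ - l} := by
        intro m₂ hm₂
        rw [Finset.mem_filter] at hm₂
        rw [Finset.mem_insert, Finset.mem_singleton]
        have := hm₂.2
        unfold Nat.dist at this; omega
      exact (Finset.card_le_card hsub).trans (Finset.card_le_two)
  have hsumB : ∑ l ∈ Finset.range (L + 1), B l =
      ((Nat.primesLE N).card : ℝ) + C₁ * 2 * W * ∑ l ∈ Finset.Icc 1 L, romanovWeight l := by
    rw [Finset.sum_range_succ', Finset.mul_sum]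
    have h0 : B 0 = ((Nat.primesLE N).card : ℝ) := by simp [hBdef]
    rw [h0, add_comm]
    congr 1
    rw [← Finset.Ico_add_one_right_eq_Icc, Finset.sum_Ico_eq_sum_range, Nat.add_sub_cancel]
    refine Finset.sum_congr rfl fun i _ => ?_
    rw [Nat.add_comm 1 i]
    simp only [hBdef, Nat.add_one_ne_zero, ↓reduceIte]
    ring
  -- Romanov's lemma and the elementary bounds
  have hRom : ∑ l ∈ Finset.Icc 1 L, romanovWeight l ≤ K * L := by
    have := sum_twoPowSubOne_div_totient_le L
    simpa [romanovWeight, hK] using this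
  have hπ : ((Nat.primesLE N).card : ℝ) ≤ 6 * N / Real.log N := by
    rw [Nat.primesLE_card_eq_primeCounting]
    have := Lichtman2020.primeCounting_le_six_mul_div_log hN
    simpa [mul_div_assoc] using this
  -- assemble
  calc ((primePowTwoQuadruples N).card : ℝ)
      = ∑ m ∈ Finset.Icc 1 L ×ˢ Finset.Icc 1 L, ((primePairsShift N m.1 m.2).card : ℝ) := by
        rw [card_primePowTwoQuadruples_eq_sum]; push_cast; rfl
    _ ≤ ∑ m ∈ Finset.Icc 1 L ×ˢ Finset.Icc 1 L, B (Nat.dist m.1 m.2) := Finset.sum_le_sum hfibre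
    _ = ∑ m₁ ∈ Finset.Icc 1 L, ∑ m₂ ∈ Finset.Icc 1 L, B (Nat.dist m₁ m₂) := Finset.sum_product _ _ _
    _ ≤ ∑ m₁ ∈ Finset.Icc 1 L, 2 * ∑ l ∈ Finset.range (L + 1), B l := Finset.sum_le_sum hrow
    _ = (L : ℝ) * (2 * (((Nat.primesLE N).card : ℝ) + C₁ * 2 * W * ∑ l ∈ Finset.Icc 1 L, romanovWeight l)) := by
        rw [Finset.sum_const, Nat.card_Icc, Nat.add_sub_cancel, nsmul_eq_mul, hsumB]
    _ ≤ (L : ℝ) * (2 * (6 * N / Real.log N + C₁ * 2 * W * (K * L))) := by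
        gcongr
    _ = 12 * (L * N / Real.log N) + 4 * C₁ * K * (L ^ 2 * W) := by ring
    _ ≤ 12 * (N / Real.log 2) + 4 * C₁ * K * (N / Real.log 2 ^ 2) := by
        have h1 : (L : ℝ) * N / Real.log N ≤ N / Real.log 2 := by
          rw [div_le_div_iff₀ hlogN0 (by linarith)]
          nlinarith
        have h2 : (L : ℝ) ^ 2 * W ≤ N / Real.log 2 ^ 2 := by
          rw [hW, ← mul_div_assoc, div_le_div_iff₀ (by positivity) (by positivity)]
          have : (L : ℝ) ^ 2 * Real.log 2 ^ 2 ≤ Real.log N ^ 2 := by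
            rw [← mul_pow]; exact pow_le_pow_left₀ (by positivity) hL' 2
          nlinarith
        gcongr
    _ ≤ (18 + 9 * C₁ * K) * N := by
        have h3 : (N : ℝ) / Real.log 2 ≤ 1.5 * N := by
          rw [div_le_iff₀ (by linarith)]; nlinarith
        have hsq : (0.48 : ℝ) ≤ Real.log 2 ^ 2 := by nlinarith
        have h4 : (N : ℝ) / Real.log 2 ^ 2 ≤ 2.25 * N := by
          rw [div_le_iff₀ (by positivity)]
          nlinarith [mul_le_mul_of_nonneg_left hsq hNpos.le]
        nlinarith [mul_nonneg hC₁0 hK0]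

/-! ### Romanov's theorem -/

/-- Romanov's set `A = {p + 2^k : p prime, k ≥ 1}`, counted in `[0, N]`.
[cite: Nathanson1996, §7.6 Theorem 7.11] -/
def romanovSet (N : ℕ) : Finset ℕ :=
  open Classical in
  (Finset.range (N + 1)).filter fun n => ∃ p k : ℕ, p.Prime ∧ 1 ≤ k ∧ p + 2 ^ k = n

/-- Collisions of a map count the squares of its fibres:
`#{(a, a') ∈ A² : f a = f a'} = ∑_{n ∈ f(A)} #f⁻¹(n)²`. [folklore] -/
theorem card_filter_prod_eq_sum_sq {α β : Type*} [DecidableEq α] [DecidableEq β]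
    (A : Finset α) (f : α → β) :
    (((A ×ˢ A).filter fun x => f x.1 = f x.2).card : ℝ) =
      ∑ n ∈ A.image f, (((A.filter fun a => f a = n).card : ℝ)) ^ 2 := by
  have h1 : ((A ×ˢ A).filter fun x => f x.1 = f x.2).card =
      ∑ a ∈ A, (A.filter fun a' => f a' = f a).card := by
    rw [Finset.card_filter, Finset.sum_product]
    refine Finset.sum_congr rfl fun a _ => ?_
    rw [Finset.card_filter]
    refine Finset.sum_congr rfl fun a' _ => ?_
    simp only [eq_comm]
  rw [h1]
  push_cast
  rw [← Finset.sum_fiberwise_of_maps_to (g := f) (fun a ha => Finset.mem_image_of_mem f ha)]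
  refine Finset.sum_congr rfl fun n _ => ?_
  rw [sq]
  calc ∑ a ∈ A with f a = n, (((A.filter fun a' => f a' = f a).card : ℝ))
      = ∑ a ∈ A with f a = n, (((A.filter fun a' => f a' = n).card : ℝ)) :=
        Finset.sum_congr rfl fun a ha => by rw [(Finset.mem_filter.mp ha).2]
    _ = _ := by rw [Finset.sum_const, nsmul_eq_mul]

/-- **Cauchy–Schwarz for fibres**: `#A² ≤ #f(A) · #{(a, a') : f a = f a'}`. This is the
inequality `(∑ r(N))² ≤ A(x) ∑ r(N)²` of Nathanson's proof of Theorem 7.11. [cite: Nathanson1996, §7.6 Theorem 7.11 (proof)] -/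
theorem card_sq_le_card_image_mul_card_filter {α β : Type*} [DecidableEq α] [DecidableEq β]
    (A : Finset α) (f : α → β) :
    ((A.card : ℝ)) ^ 2 ≤ (A.image f).card * (((A ×ˢ A).filter fun x => f x.1 = f x.2).card : ℝ) := by
  rw [card_filter_prod_eq_sum_sq, Finset.card_eq_sum_card_image f A]
  push_cast
  exact sq_sum_le_card_mul_sum_sq

/-- `⌊log₂ M⌋ ≥ log M / (2 log 2)` for `M ≥ 4`. [folklore] -/
theorem log_div_le_natLog_two {M : ℕ} (hM : 4 ≤ M) :
    Real.log M / (2 * Real.log 2) ≤ (Nat.log 2 M : ℝ) := by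
  have hl2 : 0 < Real.log 2 := Real.log_pos one_lt_two
  have hlt := Nat.lt_pow_succ_log_self (b := 2) (by norm_num) M
  have hM0 : (0 : ℝ) < M := by exact_mod_cast (by omega : 0 < M)
  have h1 : (M : ℝ) ≤ (2 : ℝ) ^ (Nat.log 2 M + 1) := by exact_mod_cast hlt.le
  have h2 := Real.log_le_log hM0 h1
  rw [Real.log_pow] at h2
  push_cast at h2
  -- `log M ≥ log 4 = 2 log 2`, so `log M / log 2 - 1 ≥ log M / (2 log 2)`
  have h4 : 2 * Real.log 2 ≤ Real.log M := by
    rw [← Real.log_rpow two_pos, show (2 : ℝ) ^ (2 : ℝ) = 4 by norm_num]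
    exact Real.log_le_log (by norm_num) (by exact_mod_cast hM)
  rw [div_le_iff₀ (by positivity)]
  nlinarith

/-- **Romanov's theorem** (Romanov 1934; Nathanson's Theorem 7.11 for `a = 2`): a positive
proportion of the integers are of the form `p + 2^k` — there are `c > 0` and `N₀` with
`#{n ≤ N : n = p + 2^k, p prime, k ≥ 1} ≥ cN` for `N ≥ N₀`. Proof as printed: Cauchy–Schwarz
(`card_sq_le_card_image_mul_card_filter`) between `∑ r(n) ≥ π(N/2) ⌊log₂(N/2)⌋ ≫ N` (prime number
theorem lower bound `Literature.NumberTheory.Sieve.Lichtman2020.eventually_primeCounting_ge`,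
Chebyshev would do) and `∑ r(n)² ≤ s(N) ≪ N` (`card_primePowTwoQuadruples_le`).
[cite: Nathanson1996, §7.6 Theorem 7.11] -/
theorem romanov :
    ∃ c : ℝ, 0 < c ∧ ∃ N₀ : ℕ, ∀ N : ℕ, N₀ ≤ N → c * N ≤ ((romanovSet N).card : ℝ) := by
  classical
  obtain ⟨C, hC⟩ := card_primePowTwoQuadruples_le
  set C' : ℝ := max C 1 with hC'def
  have hC'1 : 1 ≤ C' := le_max_right _ _
  have hC' : ∀ N : ℕ, 2 ≤ N → ((primePowTwoQuadruples N).card : ℝ) ≤ C' * N := fun N hN =>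
    (hC N hN).trans (mul_le_mul_of_nonneg_right (le_max_left _ _) (Nat.cast_nonneg N))
  obtain ⟨X₀, hX₀⟩ := Filter.eventually_atTop.mp Lichtman2020.eventually_primeCounting_ge
  refine ⟨1 / (144 * C'), by positivity, max (2 * X₀) 8, fun N hN => ?_⟩
  have hNX : 2 * X₀ ≤ N := (le_max_left _ _).trans hN
  have hN8 : 8 ≤ N := (le_max_right _ _).trans hN
  set M : ℕ := N / 2 with hMdef
  have hM4 : 4 ≤ M := by omega
  have hMX : X₀ ≤ M := by omega
  have hMN : M ≤ N := Nat.div_le_self N 2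
  have hM0 : M ≠ 0 := by omega
  have hMpos : (0 : ℝ) < M := by exact_mod_cast (by omega : 0 < M)
  have hNM : (N : ℝ) ≤ 4 * M := by
    have : N ≤ 4 * M := by omega
    exact_mod_cast this
  -- the representations `a = (p, k) ↦ p + 2^k`
  set A : Finset (ℕ × ℕ) := Nat.primesLE M ×ˢ Finset.Icc 1 (Nat.log 2 M) with hAdef
  set f : ℕ × ℕ → ℕ := fun a => a.1 + 2 ^ a.2 with hfdef
  have himage : A.image f ⊆ romanovSet N := by
    intro n hn
    obtain ⟨a, ha, rfl⟩ := Finset.mem_image.mp hn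
    rw [hAdef, Finset.mem_product, Nat.mem_primesLE, Finset.mem_Icc] at ha
    unfold romanovSet
    rw [Finset.mem_filter, Finset.mem_range]
    refine ⟨?_, a.1, a.2, ha.1.2, ha.2.1, rfl⟩
    have : 2 ^ a.2 ≤ M := (Nat.pow_le_pow_right (by norm_num) ha.2.2).trans (Nat.pow_log_le_self 2 hM0)
    simp only [hfdef]
    omega
  -- collisions inject into the Pintz–Ruzsa quadruples at level `N`
  have hcoll : (((A ×ˢ A).filter fun x => f x.1 = f x.2).card : ℝ) ≤ C' * N := by
    have hinj : ((A ×ˢ A).filter fun x => f x.1 = f x.2).card ≤ (primePowTwoQuadruples N).card := by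
      refine Finset.card_le_card_of_injOn (fun x => ((x.1.1, x.2.1), (x.1.2, x.2.2)))
        (fun x hx => ?_) fun x hx y hy hxy => ?_
      · rw [Finset.mem_coe, Finset.mem_filter, Finset.mem_product, hAdef, Finset.mem_product,
          Finset.mem_product, Nat.mem_primesLE, Nat.mem_primesLE, Finset.mem_Icc, Finset.mem_Icc] at hx
        unfold primePowTwoQuadruples
        rw [Finset.mem_coe, Finset.mem_filter]
        simp only [Finset.mem_product, Nat.mem_primesLE, Finset.mem_Icc]
        have hlog : Nat.log 2 M ≤ Nat.log 2 N := Nat.log_mono_right hMN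
        refine ⟨⟨⟨⟨hx.1.1.1.1.trans hMN, hx.1.1.1.2⟩, ⟨hx.1.2.1.1.trans hMN, hx.1.2.1.2⟩⟩,
          ⟨⟨hx.1.1.2.1, hx.1.1.2.2.trans hlog⟩, ⟨hx.1.2.2.1, hx.1.2.2.2.trans hlog⟩⟩⟩, ?_⟩
        simpa [hfdef] using hx.2
      · simp only [Prod.mk.injEq] at hxy
        obtain ⟨⟨h1, h2⟩, h3, h4⟩ := hxy
        exact Prod.ext (Prod.ext h1 h3) (Prod.ext h2 h4)
    have hN2 : 2 ≤ N := by omega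
    calc (((A ×ˢ A).filter fun x => f x.1 = f x.2).card : ℝ) ≤ ((primePowTwoQuadruples N).card : ℝ) := by
          exact_mod_cast hinj
      _ ≤ C' * N := hC' N hN2
  -- the size of `A`
  have hA : (M : ℝ) / 3 ≤ A.card := by
    rw [hAdef, Finset.card_product, Nat.primesLE_card_eq_primeCounting, Nat.card_Icc, Nat.add_sub_cancel]
    push_cast
    have hπ : (M : ℝ) / (2 * Real.log M) ≤ Nat.primeCounting M := hX₀ M hMX
    have hL : Real.log M / (2 * Real.log 2) ≤ (Nat.log 2 M : ℝ) := log_div_le_natLog_two hM4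
    have hlogM : 0 < Real.log M := Real.log_pos (by exact_mod_cast (by omega : 1 < M))
    have hl2 : (0.6931471803 : ℝ) < Real.log 2 := Real.log_two_gt_d9
    have hl2' : Real.log 2 < 0.6931471808 := Real.log_two_lt_d9
    have hprod : (M : ℝ) / (2 * Real.log M) * (Real.log M / (2 * Real.log 2)) ≤
        (Nat.primeCounting M : ℝ) * (Nat.log 2 M : ℝ) :=
      mul_le_mul hπ hL (by positivity) (Nat.cast_nonneg _)
    have heq : (M : ℝ) / (2 * Real.log M) * (Real.log M / (2 * Real.log 2)) = M / (4 * Real.log 2) := by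
      field_simp
      ring
    rw [heq] at hprod
    refine le_trans ?_ hprod
    rw [div_le_div_iff₀ (by norm_num) (by positivity)]
    nlinarith
  -- Cauchy–Schwarz and assembly
  have hCS := card_sq_le_card_image_mul_card_filter A f
  have hR : ((A.image f).card : ℝ) ≤ (romanovSet N).card := by exact_mod_cast Finset.card_le_card himage
  have hA2 : ((N : ℝ)) ^ 2 / 144 ≤ ((A.card : ℝ)) ^ 2 := by
    have h0 : (0 : ℝ) ≤ (M : ℝ) / 3 := by positivity
    have := pow_le_pow_left₀ h0 hA 2
    nlinarith
  have hkey : ((N : ℝ)) ^ 2 / 144 ≤ (romanovSet N).card * (C' * N) := by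
    calc ((N : ℝ)) ^ 2 / 144 ≤ ((A.card : ℝ)) ^ 2 := hA2
      _ ≤ (A.image f).card * (((A ×ˢ A).filter fun x => f x.1 = f x.2).card : ℝ) := hCS
      _ ≤ (romanovSet N).card * (C' * N) := mul_le_mul hR hcoll (Nat.cast_nonneg _) (Nat.cast_nonneg _)
  have hNpos : (0 : ℝ) < N := by exact_mod_cast (by omega : 0 < N)
  have hC'N : 0 < C' * N := by positivity
  rw [show 1 / (144 * C') * (N : ℝ) = ((N : ℝ) ^ 2 / 144) / (C' * N) by field_simp]
  rw [div_le_iff₀ hC'N]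
  exact hkey

end Literature.NumberTheory.Sieve.Romanov

end
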